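import Literature.AnabelianGeometry.EtaleTheta.Discharge.Sec4BaseRootLawSmallIndex
import Literature.AnabelianGeometry.EtaleTheta.Discharge.Sec5OfQuotientTemperoid
import Literature.AnabelianGeometry.EtaleTheta.TemperedFrobenioidOfThetaTwistTower
import Literature.AnabelianGeometry.EtaleTheta.LogDivisorModelTateTowerThetaTwistTowerRootLaw
import Literature.AnabelianGeometry.EtaleTheta.LogDivisorModelTateTowerKummerTwistCompatRShearTempered

/-!
# [EtTh] Def. 3.6 (ii) at the ε-free `(β)` theta tower, RE-INDEXED over the SMALL coset model `CosetCat Compat₃′` — and the FIRST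
# tower-model §4 setting at the Setting's universe (Def. 3.6 pp.302–303, Def. 4.1 pp.312–313 / PDF pp.76–77, 86–87)

S. Mochizuki, *The étale theta function …*, Publ. RIMS **45** (2009) [MochizukiEtTh2009], Def. 3.3 (iii) p.299 (PDF p.73), Def. 3.6 (i)(ii)
pp.302–303 (PDF pp.76–77), Def. 4.1 pp.312–313 (PDF pp.86–87), Prop. 4.2 (iii) p.315 (PDF p.89); S. Mochizuki, *The geometry of Frobenioids II*
(2008), Ex. 1.3 (i) p.11.  [cite: MochizukiEtTh2009, Def 3.6 p.303 (PDF p.77)]  PAGE CONVENTION for [EtTh]: «printed N (PDF p.M)», N = M + 226.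

abc-iut cell, layer L2, seat abc-iut-L2-t3 (gen 9; Def. 3.6 (ii) / `LogDivisorTower` / engine `ofPowDiagonalBase` owner lineage) — repair (U1) of
FINDING F-L2t3g9-1 AT abc-iut-L2-d2's FOURTH TOWER MODEL OF RECORD (`ThetaTwistTowerTempered.temperedFrobenioid`, p493549), per abc-iut-L2-lead
R1161 («(U1) = the repair of record, per tower model: re-index the model's Def 3.6 (i) data over the SMALL `CosetCat` with base functor
`(CosetCat.equivConnectedPart _).inverse` — the `ZTowerTempered` / `ThetaTowerTempered` pattern»).  ADDITIVE: FILE 4 is not edited; every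
one of its lemmas is consumed BY NAME at another object.  CLASS (b) construction (5 defs + laws), no instance / notation / Prop fact / sorry.

WHY.  `BiKummerSetting (X : TemperedArithmeticGroup.{u₀} K) {D₀ : Type u₀} …` (Def. 4.1) pins the Def. 3.6 (i) index category `D₀` to the
universe of the field `K` (`TemperedCurve.K : Type 0` for the Setting); FILE 4 indexes over `D₀ := ConnectedPart (BTemp Compat₃′) : Type 1`, so it
cannot enter a §4 setting over the Setting's `Π^tp_X̲̲` (probe of record `ProbeSocketAtCompat3.lean`, F-L2t3g9-1).  Here:
* `dmSmall := (DivisorMonoids.ofTower towerC₃sf).precomp (CosetCat.toConnected isTempered_compat₃')` — the SAME Def. 3.3 (iii) data read on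
  abc-iut-L5-t2's small coset model `CosetCat Compat₃′ : Type 0` ([FrdII] Ex. 1.3 (i): the connected objects ARE the coset spaces), `hpfSmall`;
* `powDiagonalBaseSmall` — FILE 4's ramified-uniformiser diagonal data with base functor `(CosetCat.equivConnectedPart _).inverse`, every field
  being FILE 4's field read at the coset re-presentation `repr A := toConnected (inverse A) ≅ A` of the covering `A` (FILE 4's lemmas are
  generic in the `Compat₃′`-set, so NO transport along the counit isomorphism is needed);
* `temperedFrobenioidSmall R S` — Def. 3.6 (ii) over `B^temp(Compat₃′)⁰` of monoid type `ℤ` via this lineage's engine `ofPowDiagonalBase`: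
  a Frobenioid (`isFrobenioid_…`), `Φ` perfect (`hP_…`), base functor the equivalence inverse (full, essentially surjective),
  `Φ^{bs-fld} ⊊ Φ` at every covering (the class of the zero divisor of `Θ̈`, FILE 4's argument at `repr A`);
* **`settingSmall X φ hφ R S NH M : BiKummerSetting X (ofRlfZWeak dmSmall hpfSmall) (ConnectedPart (BTemp Compat₃′)) …` for
  `X : TemperedArithmeticGroup.{0} K`, `K : Type`** — abc-iut-L2-t3's quotient-base socket `BiKummerSetting.mkOfQuotientTemperoidQuot`
  (p496301) at `G := Compat₃′`, `A_⊙ := (Compat₃′/M, 0)`: the FIRST §4 setting over a multi-level tower model at the Setting's universe, with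
  `GaloisSurjNatural`, `IsOpenKerGaloisSurj`, `H_⊙ = φ⁻¹(M)` THEOREMS (by name) and **A10 `BaseRootLaw «Galois»` a THEOREM** from E2 (a)
  `rootLawC₃sf` (p490708) through the small-index kit `baseRootLaw_galoisObj_precomp_toConnected_of_rootLaw` (p499867).
HONEST COST displayed, not hidden (memo (J3b), R1114 R-α2): the continuous SURJECTION `φ : Π^tp_X ↠ Compat₃′` is a HYPOTHESIS — the genuine
`g ↦ ((κ_ϖ, κ_Ü, κ_Θ̈)(g), χ(g), γ(g))` is not in the tree and is not onto (`χ(G_K) ⊊ Ẑˣ`); and the model is a class-(b) combinatorial DESIGN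
model (FILE 4's honest label), not the tempered Frobenioid of a Tate curve.  Nothing here bears on [IUTchIII] Cor. 3.12; typed ≠ proved.
-/

noncomputable section

namespace Literature.AnabelianGeometry.EtaleTheta

open CategoryTheory Opposite Function Literature.AlgebraicGeometry.Frobenioids Literature.AnabelianGeometry.SemiGraphs
  Literature.AnabelianGeometry.SemiGraphs.GaloisObjects LogDivisorModel LogDivisorModel.GaloisAction LogDivisorTower
  TateTowerKummerTwistRShear LogDivisorModel.TateTowerThetaTwist

namespace ThetaTwistTowerSmallIndex

open ThetaTwistTowerTempered
open TateTowerKummerTwist (N)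

/-! ## §1 The small coset model of `B^temp(Compat₃′)⁰` and the re-indexed Def. 3.3 (iii) data -/

/-- `CosetCat Compat₃′ ⥤ B^temp(Compat₃′)⁰`, `U ↦ Compat₃′/U` ([FrdII] Ex. 1.3 (i); `Compat₃′` tempered, abc-iut-L1-t6).
[cite: MochizukiFrdII2008, Ex 1.3 (i) p.11] -/
abbrev toConn : CosetCat (Compat 3 thetaShear) ⥤ ConnectedPart (BTemp (Compat 3 thetaShear)) := CosetCat.toConnected isTempered_compat₃'

/-- The equivalence `CosetCat Compat₃′ ≌ B^temp(Compat₃′)⁰`. [cite: MochizukiFrdII2008, Ex 1.3 (i) p.11] -/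
abbrev equivConn : CosetCat (Compat 3 thetaShear) ≌ ConnectedPart (BTemp (Compat 3 thetaShear)) :=
  CosetCat.equivConnectedPart isTempered_compat₃'

/-- The coset re-presentation `Compat₃′/Stab ≅ A` of a connected tempered covering `A`. [cite: MochizukiFrdII2008, Ex 1.3 (i) p.11] -/
abbrev repr (A : ConnectedPart (BTemp (Compat 3 thetaShear))) : ConnectedPart (BTemp (Compat 3 thetaShear)) :=
  toConn.obj (equivConn.inverse.obj A)

/-- The coset re-presentation is canonically isomorphic to the covering (counit of the equivalence). [cite: MochizukiFrdII2008, Ex 1.3 (i) p.11] -/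
def reprIso (A : ConnectedPart (BTemp (Compat 3 thetaShear))) : repr A ≅ A := equivConn.counitIso.app A

/-- **The coset re-presentation has the SAME LEVEL as the covering** (levels are monotone along morphisms, abc-iut-L1-t6's `lvlC_le_of_hom`,
and `repr A ≅ A`) — so every level-`n` statement about FILE 4's objects reads verbatim on the small-indexed model.
[cite: MochizukiEtTh2009, Def 3.3 (iii) p.299 (PDF p.73)] -/
theorem lvlC_repr (A : ConnectedPart (BTemp (Compat 3 thetaShear))) : lvlC 3 thetaShear (repr A) = lvlC 3 thetaShear A :=
  le_antisymm (lvlC_le_of_hom 3 thetaShear (reprIso A).inv) (lvlC_le_of_hom 3 thetaShear (reprIso A).hom)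

/-- **The Def. 3.3 (iii) data of the ε-free theta tower RE-INDEXED over the small coset model** (index category `CosetCat Compat₃′ : Type 0`).
[cite: MochizukiEtTh2009, Def 3.3 (iii) p.299 (PDF p.73)] -/
abbrev dmSmall : DivisorMonoids (CosetCat (Compat 3 thetaShear)) := (DivisorMonoids.ofTower towerC₃sf).precomp toConn

/-- Prop. 3.4 (i) (weak, cofinal perfection) at every `Φ₀(Compat₃′/U)` — FILE 4's `hpf` read on the coset model.
[cite: MochizukiEtTh2009, Prop 3.4 p.300 (PDF p.74)] -/
theorem hpfSmall (Y : (CosetCat (Compat 3 thetaShear))ᵒᵖ) : IsPerfFactorialCof (dmSmall.Φ₀.obj Y) :=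
  ThetaTwistTowerTempered.hpf _

/-! ## §2 The diagonal base data with ramified uniformiser, base functor the equivalence inverse -/

/-- **FILE 4's pattern diagonal base data, re-based along `B^temp(Compat₃′)⁰ ⥤ CosetCat Compat₃′`** (the equivalence inverse): every field is
FILE 4's field read on the `Compat₃′`-set of the coset re-presentation `repr A` (coordinates = multiplicities `coord φ₃ (s, x)`, diagonal =
reduced special fibre, constants' divisors `⊆ ⟨[diag]⟩`, ramified uniformiser `div₀ ϖ = [diag]^{N_l}`).  [cite: MochizukiEtTh2009, Def 3.6 p.303 (PDF p.77)] -/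
def powDiagonalBaseSmall : TemperedFrobenioid.PowDiagonalBase dmSmall (ConnectedPart (BTemp (Compat 3 thetaShear))) where
  F := equivConn.inverse
  I A := (gset (repr A)).V × TateTowerTheta.Idx
  i₀ A := ((isConnectedGSet_gset (repr A)).1.some, Sum.inr 0)
  κ A i := TateTowerTheta.coord φ₃ (gset (repr A)) i.1 i.2
  d A := TateTowerTheta.diag φ₃ (gset (repr A))
  κ_d₀ A := TateTowerTheta.coord_diag φ₃ (gset (repr A)) _ _
  eq_pow_of_κ_eq A _ c h := TateTowerTheta.coord_separating φ₃ (gset (repr A)) fun s x =>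
    (h (s, x)).trans (map_pow (TateTowerTheta.coord φ₃ (gset (repr A)) s x) _ c).symm
  div₀_mem_zpowers A _ hb :=
    divZeroHom_mem_zpowers_of_mem_fZero (lvlC 3 thetaShear (repr A)) (isConnectedGSet_gset (repr A)) hb
  exists_div₀_eq_pow A := ⟨unifPowFam (lvlC 3 thetaShear (repr A)) (gset (repr A)), unifPowFam_mem_fZero _ _,
    (N (lvlC 3 thetaShear (repr A)) : ℕ), PNat.pos _,
    (divZeroHom_unifPowFam (lvlC 3 thetaShear (repr A)) (gset (repr A))).trans (zpow_natCast _ _)⟩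
  hΦinj f := Φ₀_map_injective (toConn.map (equivConn.inverse.map f)).op
  hΦrefl f a b h := Φ₀_map_reflects_dvd (toConn.map (equivConn.inverse.map f)).op a b h

/-- The base functor of the data is the equivalence inverse. [cite: MochizukiEtTh2009, Def 3.6 p.303 (PDF p.77)] -/
@[simp] theorem powDiagonalBaseSmall_F : powDiagonalBaseSmall.F = equivConn.inverse := rfl

/-- The diagonal at `A` is FILE 4's `diag` on the coset re-presentation of `A`. [cite: MochizukiEtTh2009, Def 3.6 p.303 (PDF p.77)] -/
@[simp] theorem powDiagonalBaseSmall_d (A : ConnectedPart (BTemp (Compat 3 thetaShear))) :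
    powDiagonalBaseSmall.d A = TateTowerTheta.diag φ₃ (gset (repr A)) := rfl

/-! ## §3 The tempered Frobenioid over `B^temp(Compat₃′)⁰` with SMALL index -/

variable (R S : ((ConnectedPart (BTemp (Compat 3 thetaShear)))ᵒᵖ ⥤ CommMonCat.{0}) → Prop)

/-- **Def. 3.6 (ii) at the ε-free `(β)` theta tower with small index**: monoid type `ℤ`, `Φ := im(Φ₀^pf → Φ₀^rlf)`, base functor
`B^temp(Compat₃′)⁰ ⥤ CosetCat Compat₃′` the equivalence inverse; every clause proved by the engine `ofPowDiagonalBase`.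
[cite: MochizukiEtTh2009, Def 3.6 p.303 (PDF p.77)] -/
def temperedFrobenioidSmall :
    TemperedFrobenioid (RealifiedDivisorMonoids.ofRlfZWeak dmSmall hpfSmall) (ConnectedPart (BTemp (Compat 3 thetaShear)))
      (treeCatVocab (ConnectedPart (BTemp (Compat 3 thetaShear))) R S) :=
  TemperedFrobenioid.ofPowDiagonalBase hpfSmall powDiagonalBaseSmall QuasiTemperoid.BTempConnected.connectedPart_isConnected
    QuasiTemperoid.BTempConnected.connectedPart_isTotallyEpimorphic QuasiTemperoid.BTempConnected.connectedPart_isOfFSMType R S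

/-- Non-vacuity of the parameter class. [cite: MochizukiEtTh2009, Def 3.6 p.303 (PDF p.77)] -/
theorem nonempty_temperedFrobenioidSmall :
    Nonempty (TemperedFrobenioid (RealifiedDivisorMonoids.ofRlfZWeak dmSmall hpfSmall) (ConnectedPart (BTemp (Compat 3 thetaShear)))
      (treeCatVocab (ConnectedPart (BTemp (Compat 3 thetaShear))) R S)) :=
  ⟨temperedFrobenioidSmall R S⟩

/-- Its base functor is the equivalence inverse `B^temp(Compat₃′)⁰ ⥤ CosetCat Compat₃′`. [cite: MochizukiEtTh2009, Def 3.6 p.302 (PDF p.76)] -/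
theorem temperedFrobenioidSmall_base : (temperedFrobenioidSmall R S).base = equivConn.inverse := rfl

/-- The base functor is full (print's `D = D₀[𝒟] → D₀`, §3 p.301). [cite: MochizukiEtTh2009, Def 4.1 p.312 (PDF p.86)] -/
theorem temperedFrobenioidSmall_base_full : (temperedFrobenioidSmall R S).base.Full := by
  rw [temperedFrobenioidSmall_base]; infer_instance

/-- The base functor is essentially surjective. [cite: MochizukiEtTh2009, Def 4.1 p.312 (PDF p.86)] -/
theorem temperedFrobenioidSmall_base_essSurj : (temperedFrobenioidSmall R S).base.EssSurj := by
  rw [temperedFrobenioidSmall_base]; infer_instance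

/-- The monoid type is `ℤ` — the `hZ` slot of the §4 setting. [cite: MochizukiEtTh2009, Def 4.1 p.312 (PDF p.86)] -/
theorem temperedFrobenioidSmall_monoidType : (temperedFrobenioidSmall R S).monoidType = MonoidType.Z := rfl

/-- `Φ(A) = im(Φ₀(repr A)^pf → Φ₀(repr A)^rlf)`. [cite: MochizukiEtTh2009, Def 3.6 p.303 (PDF p.77)] -/
theorem temperedFrobenioidSmall_Φ_carrier (A : (ConnectedPart (BTemp (Compat 3 thetaShear)))ᵒᵖ) :
    (temperedFrobenioidSmall R S).Φ.carrier A = powDiagonalBaseSmall.pfImage hpfSmall A := rfl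

/-- Def. 3.6 (ii)(a) with content: `Φ^{bs-fld}(A) = ι(⟨diag⟩^pf)`. [cite: MochizukiEtTh2009, Def 3.6 p.303 (PDF p.77)] -/
theorem temperedFrobenioidSmall_bsFld_carrier (A : (ConnectedPart (BTemp (Compat 3 thetaShear)))ᵒᵖ) :
    (temperedFrobenioidSmall R S).bsFld.carrier A = powDiagonalBaseSmall.diagImage hpfSmall A :=
  TemperedFrobenioid.ofPowDiagonalBase_bsFld_carrier hpfSmall powDiagonalBaseSmall _ _ _ R S A

/-- **It IS a Frobenioid** ([FrdI] Thm. 5.2 (ii); `hB₀inj` = `ofTower_B₀_map_injective` along `toConnected`-images).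
[cite: MochizukiFrdI2008, Thm. 5.2 (ii) p.100] -/
theorem isFrobenioid_temperedFrobenioidSmall : PreFrobenioid.IsFrobenioid (temperedFrobenioidSmall R S).toElem :=
  TemperedFrobenioid.isFrobenioid_ofPowDiagonalBase hpfSmall powDiagonalBaseSmall _ _ _ R S fun g =>
    towerC₃sf.ofTower_B₀_map_injective (toConn.map g.unop).op

/-- `Φ(A)` is perfect — the `hP` slot of the §4 setting. [cite: MochizukiEtTh2009, Def 4.1 p.312 (PDF p.86)] -/
theorem hPSmall (A : (ConnectedPart (BTemp (Compat 3 thetaShear)))ᵒᵖ) : IsPerfect ((temperedFrobenioidSmall R S).Φ.carrier A) :=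
  TemperedFrobenioid.ofPowDiagonalBase_isPerfect hpfSmall powDiagonalBaseSmall _ _ _ R S A

/-- **`Φ^{bs-fld}(A) ⊊ Φ(A)` at EVERY connected tempered covering `A`** (the class of the zero divisor of `Θ̈` on `repr A`; FILE 4's argument).
[cite: MochizukiEtTh2009, Def 3.6 p.303 (PDF p.77)] -/
theorem exists_mem_Φ_not_mem_bsFld_small (A : ConnectedPart (BTemp (Compat 3 thetaShear))) :
    ∃ x ∈ (temperedFrobenioidSmall R S).Φ.carrier (op A), x ∉ (temperedFrobenioidSmall R S).bsFld.carrier (op A) := by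
  haveI : Nonempty (gset (repr A)).V := (isConnectedGSet_gset (repr A)).1
  have hM := hpfSmall (op (equivConn.inverse.obj A))
  refine ⟨hM.weak.toRealification (Perfection.of _ (TateTowerTheta.thetaZerosPhi φ₃ (gset (repr A)))), ⟨_, rfl⟩, ?_⟩
  rw [temperedFrobenioidSmall_bsFld_carrier]
  rintro ⟨b, hb⟩
  obtain ⟨⟨c, n⟩, rfl⟩ := Perfection.mk_surjective b
  have h1 : Perfection.mk (TateTowerTheta.diag φ₃ (gset (repr A)) ^ Multiplicative.toAdd c) n =
      Perfection.mk (TateTowerTheta.thetaZerosPhi φ₃ (gset (repr A))) 1 :=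
    PfImageWeak.toRealification_injective hM.weak hb
  obtain ⟨K, hK⟩ := Perfection.mk_eq_mk_iff.mp h1
  rw [← pow_mul, PNat.one_coe, mul_one] at hK
  exact TateTowerTheta.thetaZerosPhi_pow_ne_diag_pow φ₃ (gset (repr A)) (Nat.mul_ne_zero K.ne_zero n.ne_zero) _ hK.symm

/-- **A10 `BaseRootLaw «Galois»` is a THEOREM for the small-indexed model**, from E2 (a) `rootLawC₃sf` through the small-index kit.
[cite: MochizukiEtTh2009, Prop 4.2 (iii) p.315 (PDF p.89)] -/
theorem baseRootLaw_galois_temperedFrobenioidSmall : (temperedFrobenioidSmall R S).BaseRootLaw fun A => IsGaloisObj A.obj :=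
  TemperedFrobenioid.baseRootLaw_galoisObj_precomp_toConnected_of_rootLaw isTempered_compat₃' _ rfl rootLawC₃sf

/-! ## §4 The §4 bi-Kummer setting at the Setting's universe (`K : Type`) -/

section Setting

variable {K : Type} [Field K] (X : TemperedArithmeticGroup.{0} K) (φ : X.Pi →ₜ* Compat 3 thetaShear)
  (hφ : Function.Surjective φ)
  (NH : Subgroup (Field.absoluteGaloisGroup K) → (temperedFrobenioidSmall R S).category → ℕ+ → Prop)
  (M : OpenNormalSubgroup (Compat 3 thetaShear))

/-- **The §4 setting over the fourth tower model (small index), `A_⊙ := (Compat₃′/M, 0)`, at `K : Type 0`** — abc-iut-L2-t3's quotient-base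
socket `mkOfQuotientTemperoidQuot` at `G := Compat₃′` along a (hypothetical) continuous surjection `φ : Π^tp_X ↠ Compat₃′`.
[cite: MochizukiEtTh2009, Def 4.1 p.312 (PDF p.86)] -/
def settingSmall (φ : X.Pi →ₜ* Compat 3 thetaShear) (hφ : Function.Surjective φ)
    (NH : Subgroup (Field.absoluteGaloisGroup K) → (temperedFrobenioidSmall R S).category → ℕ+ → Prop)
    (M : OpenNormalSubgroup (Compat 3 thetaShear)) : BiKummerSetting X (RealifiedDivisorMonoids.ofRlfZWeak dmSmall hpfSmall) (ConnectedPart (BTemp (Compat 3 thetaShear)))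
    (treeCatVocab (ConnectedPart (BTemp (Compat 3 thetaShear))) R S) :=
  BiKummerSetting.mkOfQuotientTemperoidQuot X isTempered_compat₃' φ hφ (temperedFrobenioidSmall R S) rfl (hPSmall R S) NH M

/-- The setting's tempered Frobenioid is the small-indexed model (definitionally). [cite: MochizukiEtTh2009, Def 4.1 p.312 (PDF p.86)] -/
theorem settingSmall_tf : (settingSmall R S X φ hφ NH M).tf = temperedFrobenioidSmall R S := rfl

/-- **Def. 4.1 (ii) naturality** for the setting: a THEOREM (abc-iut-L2-t3's `mkOfQuotientTemperoid_galoisSurj_natural`).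
[cite: MochizukiEtTh2009, Def 4.1 (ii) p.313 (PDF p.87)] -/
theorem settingSmall_galoisSurjNatural : (settingSmall R S X φ hφ NH M).GaloisSurjNatural :=
  BiKummerSetting.mkOfQuotientTemperoid_galoisSurj_natural X isTempered_compat₃' φ hφ _ rfl (hPSmall R S) NH _ _ _

/-- **Def. 4.1 (ii), open kernels** for the setting: a THEOREM. [cite: MochizukiEtTh2009, Def 4.1 (ii) p.313 (PDF p.87)] -/
theorem settingSmall_isOpenKerGaloisSurj : (settingSmall R S X φ hφ NH M).IsOpenKerGaloisSurj :=
  BiKummerSetting.mkOfQuotientTemperoid_isOpen_ker_galoisSurj X isTempered_compat₃' φ hφ _ rfl (hPSmall R S) NH _ _ _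

/-- **`H_⊙ = φ⁻¹(M)`** for the setting. [cite: MochizukiEtTh2009, Def 4.1 p.312 (PDF p.86)] -/
theorem settingSmall_Hodot : (settingSmall R S X φ hφ NH M).Hodot = M.toSubgroup.comap φ.toMonoidHom :=
  BiKummerSetting.Hodot_mkOfQuotientTemperoidQuot X isTempered_compat₃' φ hφ _ rfl (hPSmall R S) NH M

/-- **A10 for the setting's tempered Frobenioid with the setting's own Galois predicate** (`IsGaloisObj ∘ obj`), from E2 (a).
[cite: MochizukiEtTh2009, Prop 4.2 (iii) p.315 (PDF p.89)] -/
theorem settingSmall_baseRootLaw :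
    (settingSmall R S X φ hφ NH M).tf.BaseRootLaw (settingSmall R S X φ hφ NH M).IsGaloisObj :=
  baseRootLaw_galois_temperedFrobenioidSmall R S

/-- **ENTRY THEOREM — non-vacuity: a §4 bi-Kummer setting over a MULTI-LEVEL tower model EXISTS at the Setting's universe `K : Type`**
(every `X`, every continuous surjection `φ`, `R`, `S`, `NH`, `M`; the probe of record `ProbeSmallIndexAtCompat3.lean` made a theorem).  [cite: MochizukiEtTh2009, Def 4.1 p.312 (PDF p.86)] -/
theorem nonempty_settingSmall (φ : X.Pi →ₜ* Compat 3 thetaShear) (hφ : Function.Surjective φ)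
    (NH : Subgroup (Field.absoluteGaloisGroup K) → (temperedFrobenioidSmall R S).category → ℕ+ → Prop)
    (M : OpenNormalSubgroup (Compat 3 thetaShear)) :
    Nonempty (BiKummerSetting X (RealifiedDivisorMonoids.ofRlfZWeak dmSmall hpfSmall) (ConnectedPart (BTemp (Compat 3 thetaShear)))
      (treeCatVocab (ConnectedPart (BTemp (Compat 3 thetaShear))) R S)) :=
  ⟨settingSmall R S X φ hφ NH M⟩

end Setting

end ThetaTwistTowerSmallIndex

end Literature.AnabelianGeometry.EtaleTheta

end
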